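import Mathlib.Analysis.Normed.Unbundled.RingSeminorm
import Literature.MathematicalPhysics.QuantumFieldTheory.Balaban1983to89.Beta.AveragingMixedJetTables

/-!
# `BalabanUV.Beta.D1BFx.TruncatedAlgebraNorms` — road «BF-x» for binder row D1, junction (J1), the (rest) row's table letter «SYMMIX-MASS», FILE 1 of 5:
# **SUBMULTIPLICATIVE SEMINORM BOOKKEEPING FOR an1's TRUNCATED CALCULUS** — Mathlib's `RingSeminorm` with the two extra letters `ν 1 ≤ 1`, `ν(c·x) ≤ |c|·ν x`
# carried as hypotheses where used, the letters `ν(expT x) ∕ ν(logT g) ∕ ν(invT g) ∕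
# ν(holG G Ḡ l)` (plain and `− 1`-reduced), the `ℓ¹` lifts through `DualNumber` (hence through `Tau = (𝔸[τ₁])[τ₂]` and `Rho = (Tau 𝔸)[σ]`), and the
# closed-form constant chain `plog ∕ pexp ∕ phiC ∕ psiC ∕ Kmix` with the numeral `Kmix (3∕22) ≤ 8∕5`

HONEST DEPENDENCY (cell records, verbatim): «continuum YM on T⁴ ⇐ BetaPertH ∧ nine spine estimates (0/9 proved); BetaPertH ⇐ (D1) ∧ (D4) ∧
CAP+tail; G-an2-4 gates asym, D1 and NE2/3/4.»  HONEST FRAMING (cell contract, verbatim): «discharging `BetaPertH` makes Bałaban's UV stability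
UNCONDITIONAL — a real constructive-QFT result; it is NOT the continuum limit and NOT the Clay problem.»  THIS MODULE DISCHARGES NOTHING of the
wall: [folklore] inequalities about an ARBITRARY Mathlib `RingSeminorm ν` on an arbitrary `ℚ`-algebra (the two extra letters `ν 1 ≤ 1` and
`ν (algebraMap ℚ R c * x) ≤ |c|·ν x` are HYPOTHESES `h1 ∕ hs` of the lemmas that use them — properties of OUR norms, proved in FILES 2 ∕ 4, never of a row), applied to
node 12's `expT ∕ logT ∕ invT ∕ holG ∕ realize ∕ δ ∕ LettersIn` (lit `AveragingThirdJet`, `AveragingHessianKernels`) BY NAME.  DEFINITION lane: the lifts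
`restrictRS ∕ dualRS ∕ tauRS ∕ rhoRS` (Mathlib `RingSeminorm` structures) and five real polynomials; 0 cite, 0 `def … : Prop`, 0 sorry.  It prices NO word and proves NO (1.22) row; 0 root-level binders of row D1 discharged
(hW ∕ hR-sockets ∕ hSX-socket ∕ D1Tel ∕ D1Rep = 0); (J1) ONE OPEN ROW; (K) NOT closed; NOT D1, NEVER «G-an2-4 closed», NOT `BetaPertH`, NOT continuum, NOT Clay.

ABSOLUTE RULE (cell charter, verbatim): «No internally-minted statement may enter as a cited fact. Every hypothesis is either kernel-proved in
this package or a verbatim quotation of a PUBLISHED theorem with page reference. The manuscript(s) under audit are NOT citable for their own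
disputed steps — they are the thing under adjudication; programme-internal (2001/route/tribunal) claims are never citable.»

WHY.  an1's reference-block mass `symMixAbs ρ L = Σ_μ Σ_{(f,f′,g) ∈ bondSet³} |t_sym(f,f′;g)|` of the symmetrised MIXED table is DEFINED by word-coefficient
extraction from the jet `symMjetAt = c11 ((logT (Φ(U)·invT Φ(E))).snd)` — there are no count words for it (unlike the first-order tables).  Its n-law is
read off ONE submultiplicative seminorm on a word-recording matrix algebra (FILES 2–4) pushed through the truncated calculus by the letters of this file:
products multiply bounds, `expT ∕ logT ∕ invT` are cubic polynomials, holonomies of `ℓ` letters with `ν(U − 1) ≤ m − 1` have `ν(hol − 1) ≤ m^ℓ − 1`.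

CONTENT ([folklore] throughout).
* §1 for `ν : RingSeminorm R`: `sub_one_le`, `sum_le_card_mul`, `sq_cube_le`, **`expT_le`**, **`logT_le`**, **`invT_le`**, **`holG_le`** (`≤ m^{|l|}`),
  `le_of_sub_one_le`, **`holG_sub_one_le`** (`ν(hol − 1) ≤ m^{|l|} − 1`), **`expT_sub_one_le`**, **`invT_sub_one_le`**, `mul_sub_one_le`; `restrictRS` (subalgebras).
* §2 `dualRS ν (a + εm) := ν a + ν m` as a `RingSeminorm (DualNumber R)` (Leibniz keeps submultiplicativity); `tauRS`, `rhoRS`, `dualRS_apply ∕ tauRS_mk ∕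
  rhoRS_dmk`, the transfer of `h1 ∕ hs` (`dualRS_one_le ∕ dualRS_smul_le`, `tau ∕ rho` versions), **`c11_snd_le_rhoRS`** (the `τ₁τ₂σ`-coefficient is dominated).
* §3 the constants `plog b := b + b²∕2 + b³∕3`, `pexp a := a + a²∕2 + a³∕6`, `phiC β := pexp (plog β)·(1+β) + β`, `psiC β := φ + φ² + φ³`,
  `Kmix β := plog (φψ + φ + ψ)`; nonnegativity; **`Kmix_num : Kmix (3∕22) ≤ 8∕5`** (`norm_num`); `one_add_pow_le : (1+t)^n ≤ 1∕(1 − n t)`.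
NOT HERE: any matrix, any table, any value; the weighted operator norm (FILE 2 `WeightedRowSumNorm`), the recording algebra (FILE 3), the letter (FILE 5).
Unit `b2b-balaban-beta-d1-formalise-leaf-04` (gen 29), D1 formalisation swarm LEAF PROVER 04, road «BF-x» supplier; INTENT I-leaf04-g29-1 «SYMMIX-MASS»
(journal), taking the OWNER d1-p2 g25's located WANTED «the n-law of `symMixAbs`» (W-g25-9 (a)).  Not in print; our bookkeeping.  No existing file touched.
-/

noncomputable section

open Finset
open scoped BigOperators
open Literature.MathematicalPhysics.QuantumFieldTheory.Balaban1983to89.Beta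
open Literature.MathematicalPhysics.QuantumFieldTheory.Balaban1983to89.Beta.AffineAveraging
open Literature.MathematicalPhysics.QuantumFieldTheory.Balaban1983to89.Beta.AveragingHessianKernels
open Literature.MathematicalPhysics.QuantumFieldTheory.Balaban1983to89.Beta.AveragingThirdJet
open Literature.MathematicalPhysics.QuantumFieldTheory.Balaban1983to89.Beta.AveragingMixedJetTables

namespace Summit.QuantumFields.BalabanUV.Beta.D1BFx.TruncatedAlgebraNorms

/-! ## §1 Letters of a submultiplicative seminorm in an1's truncated calculus -/

section Letters

variable {R : Type*} [Ring R] [Algebra ℚ R] (ν : RingSeminorm R)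

omit [Algebra ℚ R] in
/-- [folklore] `ν (g − 1) ≤ ν g + 1` when `ν 1 ≤ 1`. -/
theorem sub_one_le (h1 : ν 1 ≤ 1) (g : R) : ν (g - 1) ≤ ν g + 1 :=
  (map_sub_le_add ν g 1).trans (by linarith)

omit [Algebra ℚ R] in
/-- [folklore] `ν g ≤ b + 1` when `ν (g − 1) ≤ b` and `ν 1 ≤ 1`. -/
theorem le_of_sub_one_le (h1 : ν 1 ≤ 1) {g : R} {b : ℝ} (h : ν (g - 1) ≤ b) : ν g ≤ b + 1 := by
  have := map_add_le_add ν (g - 1) 1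
  rw [sub_add_cancel] at this
  linarith

omit [Algebra ℚ R] in
/-- [folklore] A sum of `#s` terms each of seminorm `≤ m` has seminorm `≤ #s·m`. -/
theorem sum_le_card_mul {ι : Type*} (s : Finset ι) (f : ι → R) {m : ℝ} (h : ∀ i ∈ s, ν (f i) ≤ m) :
    ν (∑ i ∈ s, f i) ≤ s.card * m := by
  classical
  induction s using Finset.induction_on with
  | empty => simp
  | insert a s ha ih =>
    rw [Finset.sum_insert ha, Finset.card_insert_of_notMem ha]
    have h' := ih fun i hi => h i (Finset.mem_insert_of_mem hi)
    have ha' := h a (Finset.mem_insert_self a s)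
    push_cast
    linarith [map_add_le_add ν (f a) (∑ i ∈ s, f i)]

omit [Algebra ℚ R] in
/-- [folklore] `ν (x·x) ≤ a²` and `ν (x·x·x) ≤ a³` when `ν x ≤ a`. -/
theorem sq_cube_le {x : R} {a : ℝ} (h : ν x ≤ a) : ν (x * x) ≤ a ^ 2 ∧ ν (x * x * x) ≤ a ^ 3 := by
  have h0 : 0 ≤ ν x := apply_nonneg ν x
  have h2 : ν (x * x) ≤ a ^ 2 := (map_mul_le_mul ν x x).trans (by rw [sq]; exact mul_le_mul h h h0 (h0.trans h))
  refine ⟨h2, (map_mul_le_mul ν _ _).trans ?_⟩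
  rw [pow_succ]
  exact mul_le_mul h2 h h0 (by positivity)

/-- [folklore] **`ν (expT x) ≤ 1 + a + a²∕2 + a³∕6`** when `ν x ≤ a` (`ν 1 ≤ 1`, `ν (c • y) ≤ |c|·ν y`). -/
theorem expT_le (h1 : ν 1 ≤ 1) (hs : ∀ (c : ℚ) (y : R), ν (algebraMap ℚ R c * y) ≤ |(c : ℝ)| * ν y) {x : R} {a : ℝ} (h : ν x ≤ a) :
    ν (expT ℚ x) ≤ 1 + a + a ^ 2 / 2 + a ^ 3 / 6 := by
  obtain ⟨h2, h3⟩ := sq_cube_le ν h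
  have e2 : ν ((2 : ℚ)⁻¹ • (x * x)) ≤ a ^ 2 / 2 := by
    rw [Algebra.smul_def]; exact (hs _ _).trans (by rw [show |((2⁻¹ : ℚ) : ℝ)| = 1 / 2 by norm_num]; linarith)
  have e3 : ν ((6 : ℚ)⁻¹ • (x * x * x)) ≤ a ^ 3 / 6 := by
    rw [Algebra.smul_def]; exact (hs _ _).trans (by rw [show |((6⁻¹ : ℚ) : ℝ)| = 1 / 6 by norm_num]; linarith)
  unfold expT
  linarith [map_add_le_add ν (1 + x + (2 : ℚ)⁻¹ • (x * x)) ((6 : ℚ)⁻¹ • (x * x * x)), map_add_le_add ν (1 + x) ((2 : ℚ)⁻¹ • (x * x)),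
    map_add_le_add ν 1 x]

/-- [folklore] **`ν (expT x − 1) ≤ a + a²∕2 + a³∕6`** when `ν x ≤ a`. -/
theorem expT_sub_one_le (hs : ∀ (c : ℚ) (y : R), ν (algebraMap ℚ R c * y) ≤ |(c : ℝ)| * ν y) {x : R} {a : ℝ} (h : ν x ≤ a) :
    ν (expT ℚ x - 1) ≤ a + a ^ 2 / 2 + a ^ 3 / 6 := by
  obtain ⟨h2, h3⟩ := sq_cube_le ν h
  have e2 : ν ((2 : ℚ)⁻¹ • (x * x)) ≤ a ^ 2 / 2 := by
    rw [Algebra.smul_def]; exact (hs _ _).trans (by rw [show |((2⁻¹ : ℚ) : ℝ)| = 1 / 2 by norm_num]; linarith)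
  have e3 : ν ((6 : ℚ)⁻¹ • (x * x * x)) ≤ a ^ 3 / 6 := by
    rw [Algebra.smul_def]; exact (hs _ _).trans (by rw [show |((6⁻¹ : ℚ) : ℝ)| = 1 / 6 by norm_num]; linarith)
  have e : expT ℚ x - 1 = x + (2 : ℚ)⁻¹ • (x * x) + (6 : ℚ)⁻¹ • (x * x * x) := by unfold expT; abel
  rw [e]
  linarith [map_add_le_add ν (x + (2 : ℚ)⁻¹ • (x * x)) ((6 : ℚ)⁻¹ • (x * x * x)), map_add_le_add ν x ((2 : ℚ)⁻¹ • (x * x))]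

/-- [folklore] **`ν (logT g) ≤ b + b²∕2 + b³∕3`** when `ν (g − 1) ≤ b`. -/
theorem logT_le (hs : ∀ (c : ℚ) (y : R), ν (algebraMap ℚ R c * y) ≤ |(c : ℝ)| * ν y) {g : R} {b : ℝ} (h : ν (g - 1) ≤ b) :
    ν (logT ℚ g) ≤ b + b ^ 2 / 2 + b ^ 3 / 3 := by
  obtain ⟨h2, h3⟩ := sq_cube_le ν h
  have e2 : ν ((2 : ℚ)⁻¹ • ((g - 1) * (g - 1))) ≤ b ^ 2 / 2 := by
    rw [Algebra.smul_def]; exact (hs _ _).trans (by rw [show |((2⁻¹ : ℚ) : ℝ)| = 1 / 2 by norm_num]; linarith)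
  have e3 : ν ((3 : ℚ)⁻¹ • ((g - 1) * (g - 1) * (g - 1))) ≤ b ^ 3 / 3 := by
    rw [Algebra.smul_def]; exact (hs _ _).trans (by rw [show |((3⁻¹ : ℚ) : ℝ)| = 1 / 3 by norm_num]; linarith)
  unfold logT
  linarith [map_add_le_add ν ((g - 1) - (2 : ℚ)⁻¹ • ((g - 1) * (g - 1))) ((3 : ℚ)⁻¹ • ((g - 1) * (g - 1) * (g - 1))),
    map_sub_le_add ν (g - 1) ((2 : ℚ)⁻¹ • ((g - 1) * (g - 1)))]

omit [Algebra ℚ R] in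
/-- [folklore] **`ν (invT g) ≤ 1 + b + b² + b³`** when `ν (g − 1) ≤ b` and `ν 1 ≤ 1`. -/
theorem invT_le (h1 : ν 1 ≤ 1) {g : R} {b : ℝ} (h : ν (g - 1) ≤ b) : ν (invT g) ≤ 1 + b + b ^ 2 + b ^ 3 := by
  obtain ⟨h2, h3⟩ := sq_cube_le ν h
  unfold invT
  linarith [map_sub_le_add ν (1 - (g - 1) + (g - 1) * (g - 1)) ((g - 1) * (g - 1) * (g - 1)),
    map_add_le_add ν (1 - (g - 1)) ((g - 1) * (g - 1)), map_sub_le_add ν 1 (g - 1)]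

omit [Algebra ℚ R] in
/-- [folklore] **`ν (invT g − 1) ≤ b + b² + b³`** when `ν (g − 1) ≤ b`. -/
theorem invT_sub_one_le {g : R} {b : ℝ} (h : ν (g - 1) ≤ b) : ν (invT g - 1) ≤ b + b ^ 2 + b ^ 3 := by
  obtain ⟨h2, h3⟩ := sq_cube_le ν h
  have e : invT g - 1 = -(g - 1) + (g - 1) * (g - 1) - (g - 1) * (g - 1) * (g - 1) := by unfold invT; abel
  rw [e]
  linarith [map_sub_le_add ν (-(g - 1) + (g - 1) * (g - 1)) ((g - 1) * (g - 1) * (g - 1)),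
    map_add_le_add ν (-(g - 1)) ((g - 1) * (g - 1)), map_neg_eq_map ν (g - 1)]

omit [Algebra ℚ R] in
/-- [folklore] `ν (u·v − 1) ≤ φ·ψ + φ + ψ` when `ν (u − 1) ≤ φ`, `ν (v − 1) ≤ ψ` (`uv − 1 = (u−1)(v−1) + (u−1) + (v−1)`). -/
theorem mul_sub_one_le {u v : R} {φ ψ : ℝ} (hu : ν (u - 1) ≤ φ) (hv : ν (v - 1) ≤ ψ) : ν (u * v - 1) ≤ φ * ψ + φ + ψ := by
  have e : u * v - 1 = (u - 1) * (v - 1) + (u - 1) + (v - 1) := by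
    simp only [sub_mul, mul_sub, one_mul, mul_one]; abel
  rw [e]
  have h0 : 0 ≤ ν (u - 1) := apply_nonneg ν _
  calc ν ((u - 1) * (v - 1) + (u - 1) + (v - 1)) ≤ ν (u - 1) * ν (v - 1) + ν (u - 1) + ν (v - 1) := by
        linarith [map_add_le_add ν ((u - 1) * (v - 1) + (u - 1)) (v - 1), map_add_le_add ν ((u - 1) * (v - 1)) (u - 1),
          map_mul_le_mul ν (u - 1) (v - 1)]
    _ ≤ φ * ψ + φ + ψ := by
        have := mul_le_mul hu hv (apply_nonneg ν _) (h0.trans hu)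
        linarith

omit [Algebra ℚ R] in
/-- [folklore] **HOLONOMY LETTER**: if every letter of `l` is `±δ` at a bond whose transporters have seminorm `≤ m` (`1 ≤ m`, `ν 1 ≤ 1`), then
`ν (holG G Ḡ l) ≤ m ^ |l|`. -/
theorem holG_le (h1 : ν 1 ≤ 1) {d : ℕ} {G Gb : Form1 d R} {P : (Fin d → ℤ) → Prop} {m : ℝ} (hm : 1 ≤ m)
    (hG : ∀ κ x, P x → ν (G κ x) ≤ m) (hGb : ∀ κ x, P x → ν (Gb κ x) ≤ m) {l : List (LetterGrp d)} (h : LettersIn δ P l) :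
    ν (holG G Gb l) ≤ m ^ l.length := by
  induction l with
  | nil => simpa using h1
  | cons a l ih0 =>
    have ha : ∃ κ x, P x ∧ (a = δ κ x ∨ a = -δ κ x) := h a (by simp)
    have hl : LettersIn δ P l := fun b hb => h b (by simp [hb])
    have ih := ih0 hl
    obtain ⟨κ, x, hx, rfl | rfl⟩ := ha
    · rw [holG_cons, realize_delta, List.length_cons, pow_succ']
      exact (map_mul_le_mul ν _ _).trans (mul_le_mul (hG κ x hx) ih (apply_nonneg ν _) (by linarith))
    · rw [holG_cons, realize_neg_delta, List.length_cons, pow_succ']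
      exact (map_mul_le_mul ν _ _).trans (mul_le_mul (hGb κ x hx) ih (apply_nonneg ν _) (by linarith))

omit [Algebra ℚ R] in
/-- [folklore] **HOLONOMY LETTER, REDUCED FORM**: if every letter of `l` is `±δ` at a bond whose transporters `U` have `ν (U − 1) ≤ m − 1`
(`1 ≤ m`, `ν 1 ≤ 1`), then `ν (holG G Ḡ l − 1) ≤ m ^ |l| − 1`. -/
theorem holG_sub_one_le (h1 : ν 1 ≤ 1) {d : ℕ} {G Gb : Form1 d R} {P : (Fin d → ℤ) → Prop} {m : ℝ} (hm : 1 ≤ m)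
    (hG : ∀ κ x, P x → ν (G κ x - 1) ≤ m - 1) (hGb : ∀ κ x, P x → ν (Gb κ x - 1) ≤ m - 1) {l : List (LetterGrp d)}
    (h : LettersIn δ P l) : ν (holG G Gb l - 1) ≤ m ^ l.length - 1 := by
  induction l with
  | nil => simp
  | cons a l ih0 =>
    have ha : ∃ κ x, P x ∧ (a = δ κ x ∨ a = -δ κ x) := h a (by simp)
    have hl : LettersIn δ P l := fun b hb => h b (by simp [hb])
    have ih := ih0 hl
    have key : ∀ u : R, ν (u - 1) ≤ m - 1 → ν (u * holG G Gb l - 1) ≤ m ^ (l.length + 1) - 1 := by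
      intro u hu
      have hu' : ν u ≤ m := by linarith [le_of_sub_one_le ν h1 hu]
      have e : u * holG G Gb l - 1 = u * (holG G Gb l - 1) + (u - 1) := by rw [mul_sub, mul_one]; abel
      rw [e, pow_succ]
      calc ν (u * (holG G Gb l - 1) + (u - 1)) ≤ ν u * ν (holG G Gb l - 1) + ν (u - 1) := by
            linarith [map_add_le_add ν (u * (holG G Gb l - 1)) (u - 1), map_mul_le_mul ν u (holG G Gb l - 1)]
        _ ≤ m * (m ^ l.length - 1) + (m - 1) := by
            have := mul_le_mul hu' ih (apply_nonneg ν _) (by linarith)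
            linarith
        _ = m ^ l.length * m - 1 := by ring
    obtain ⟨κ, x, hx, rfl | rfl⟩ := ha
    · rw [holG_cons, realize_delta, List.length_cons]; exact key _ (hG κ x hx)
    · rw [holG_cons, realize_neg_delta, List.length_cons]; exact key _ (hGb κ x hx)

/-- [our object] RESTRICTION of a ring seminorm to a `ℚ`-subalgebra. -/
def restrictRS (A : Subalgebra ℚ R) : RingSeminorm A where
  toFun x := ν (x : R)
  map_zero' := by simp
  add_le' x y := by simpa using map_add_le_add ν (x : R) (y : R)
  neg' x := by simp [map_neg_eq_map]
  mul_le' x y := by simpa using map_mul_le_mul ν (x : R) (y : R)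

/-- [folklore] The restriction evaluates as `ν` on the coercion. -/
@[simp] theorem restrictRS_apply (A : Subalgebra ℚ R) (x : A) : restrictRS ν A x = ν (x : R) := rfl

end Letters

/-! ## §2 The dual-number lift `ν(a + εm) := ν a + ν m` (Leibniz keeps submultiplicativity); `Tau` and `Rho` -/

section Dual

variable {R : Type*} [Ring R] [Algebra ℚ R] (ν : RingSeminorm R)

/-- [our object] The `ℓ¹` lift of a ring seminorm to the dual numbers, as a Mathlib `RingSeminorm`. -/
def dualRS : RingSeminorm (DualNumber R) where
  toFun q := ν q.fst + ν q.snd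
  map_zero' := by simp
  add_le' p q := by
    simp only [TrivSqZeroExt.fst_add, TrivSqZeroExt.snd_add]
    linarith [map_add_le_add ν p.fst q.fst, map_add_le_add ν p.snd q.snd]
  neg' q := by simp [map_neg_eq_map]
  mul_le' p q := by
    simp only [dfst_mul, dsnd_mul]
    have h1 := map_mul_le_mul ν p.fst q.fst
    have h2 := (map_add_le_add ν _ _).trans (add_le_add (map_mul_le_mul ν p.fst q.snd) (map_mul_le_mul ν p.snd q.fst))
    nlinarith [apply_nonneg ν p.fst, apply_nonneg ν p.snd, apply_nonneg ν q.fst, apply_nonneg ν q.snd]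

omit [Algebra ℚ R] in
/-- [folklore] The lift by components. -/
@[simp] theorem dualRS_apply (q : DualNumber R) : dualRS ν q = ν q.fst + ν q.snd := rfl

omit [Algebra ℚ R] in
/-- [folklore] `ν 1 ≤ 1` transfers to the lift. -/
theorem dualRS_one_le (h1 : ν 1 ≤ 1) : dualRS ν 1 ≤ 1 := by
  rw [dualRS_apply, TrivSqZeroExt.fst_one, TrivSqZeroExt.snd_one, map_zero, add_zero]; exact h1

/-- [folklore] `ν (c·x) ≤ |c|·ν x` (scalars through `algebraMap`) transfers to the lift. -/
theorem dualRS_smul_le (hs : ∀ (c : ℚ) (y : R), ν (algebraMap ℚ R c * y) ≤ |(c : ℝ)| * ν y) (c : ℚ) (q : DualNumber R) :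
    dualRS ν (algebraMap ℚ (DualNumber R) c * q) ≤ |(c : ℝ)| * dualRS ν q := by
  rw [dualRS_apply, dualRS_apply, TrivSqZeroExt.algebraMap_eq_inl', dfst_mul, dsnd_mul, TrivSqZeroExt.fst_inl, TrivSqZeroExt.snd_inl,
    zero_mul, add_zero, mul_add]
  exact add_le_add (hs c q.fst) (hs c q.snd)

/-- [our object] The lift to an1's `Tau R = (R[τ₁])[τ₂]`: `ν(c00) + ν(c10) + (ν(c01) + ν(c11))`. -/
def tauRS : RingSeminorm (Tau R) := dualRS (dualRS ν)

/-- [our object] The lift to an1's `Rho R = (Tau R)[σ]`. -/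
def rhoRS : RingSeminorm (Rho R) := dualRS (tauRS ν)

omit [Algebra ℚ R] in
/-- [folklore] `tauRS` by components. -/
theorem tauRS_apply (q : Tau R) : tauRS ν q = ν (Tau.c00 q) + ν (Tau.c10 q) + (ν (Tau.c01 q) + ν (Tau.c11 q)) := rfl

omit [Algebra ℚ R] in
/-- [folklore] `tauRS` on `Tau.mk`. -/
@[simp] theorem tauRS_mk (a b c e : R) : tauRS ν (Tau.mk a b c e) = ν a + ν b + (ν c + ν e) := rfl

omit [Algebra ℚ R] in
/-- [folklore] `rhoRS` by components. -/
theorem rhoRS_apply (z : Rho R) : rhoRS ν z = tauRS ν z.fst + tauRS ν z.snd := rfl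

omit [Algebra ℚ R] in
/-- [folklore] `rhoRS` on `dmk`. -/
@[simp] theorem rhoRS_dmk (p q : Tau R) : rhoRS ν (dmk p q) = tauRS ν p + tauRS ν q := rfl

omit [Algebra ℚ R] in
/-- [folklore] `ν 1 ≤ 1` transfers to `tauRS` and `rhoRS`. -/
theorem tauRS_one_le (h1 : ν 1 ≤ 1) : tauRS ν 1 ≤ 1 := dualRS_one_le _ (dualRS_one_le ν h1)

omit [Algebra ℚ R] in
/-- [folklore] -/
theorem rhoRS_one_le (h1 : ν 1 ≤ 1) : rhoRS ν 1 ≤ 1 := dualRS_one_le _ (tauRS_one_le ν h1)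

/-- [folklore] `ν (c • x) ≤ |c|·ν x` transfers to `tauRS` and `rhoRS`. -/
theorem tauRS_smul_le (hs : ∀ (c : ℚ) (y : R), ν (algebraMap ℚ R c * y) ≤ |(c : ℝ)| * ν y) (c : ℚ) (q : Tau R) :
    tauRS ν (algebraMap ℚ (Tau R) c * q) ≤ |(c : ℝ)| * tauRS ν q := dualRS_smul_le _ (dualRS_smul_le ν hs) c q

/-- [folklore] -/
theorem rhoRS_smul_le (hs : ∀ (c : ℚ) (y : R), ν (algebraMap ℚ R c * y) ≤ |(c : ℝ)| * ν y) (c : ℚ) (z : Rho R) :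
    rhoRS ν (algebraMap ℚ (Rho R) c * z) ≤ |(c : ℝ)| * rhoRS ν z := dualRS_smul_le _ (tauRS_smul_le ν hs) c z

omit [Algebra ℚ R] in
/-- [folklore] The `τ₁τ₂σ`-coefficient is dominated by the `Rho` lift: `ν (c11 z.snd) ≤ rhoRS ν z`. -/
theorem c11_snd_le_rhoRS (z : Rho R) : ν (Tau.c11 z.snd) ≤ rhoRS ν z := by
  rw [rhoRS_apply, tauRS_apply, tauRS_apply]
  have := apply_nonneg ν (Tau.c00 z.fst); have := apply_nonneg ν (Tau.c10 z.fst); have := apply_nonneg ν (Tau.c01 z.fst)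
  have := apply_nonneg ν (Tau.c11 z.fst); have := apply_nonneg ν (Tau.c00 z.snd); have := apply_nonneg ν (Tau.c10 z.snd)
  have := apply_nonneg ν (Tau.c01 z.snd)
  linarith

end Dual

/-! ## §3 The closed-form constant chain of the mixed-table letter and an elementary power bound -/

section Constants

/-- [our object] `b + b²∕2 + b³∕3` (the `logT` majorant). -/
def plog (b : ℝ) : ℝ := b + b ^ 2 / 2 + b ^ 3 / 3

/-- [our object] `a + a²∕2 + a³∕6` (the `expT − 1` majorant). -/
def pexp (a : ℝ) : ℝ := a + a ^ 2 / 2 + a ^ 3 / 6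

/-- [our object] `φ(β) := pexp (plog β)·(1 + β) + β` (majorant of `Φ − 1` when loop and segment holonomies have `ν(hol − 1) ≤ β`). -/
def phiC (β : ℝ) : ℝ := pexp (plog β) * (1 + β) + β

/-- [our object] `ψ(β) := φ + φ² + φ³` (majorant of `invT Φ − 1`). -/
def psiC (β : ℝ) : ℝ := phiC β + phiC β ^ 2 + phiC β ^ 3

/-- [our object] THE CONSTANT CHAIN `K(β) := plog (φψ + φ + ψ)` (majorant of the mixed jet's `logT(Φ_U · invT Φ_E)`). -/
def Kmix (β : ℝ) : ℝ := plog (phiC β * psiC β + phiC β + psiC β)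

/-- [folklore] `0 ≤ plog b` for `0 ≤ b`. -/
theorem plog_nonneg {b : ℝ} (hb : 0 ≤ b) : 0 ≤ plog b := by unfold plog; positivity

/-- [folklore] `0 ≤ pexp a` for `0 ≤ a`. -/
theorem pexp_nonneg {a : ℝ} (ha : 0 ≤ a) : 0 ≤ pexp a := by unfold pexp; positivity

/-- [folklore] `0 ≤ phiC β` for `0 ≤ β`. -/
theorem phiC_nonneg {β : ℝ} (hβ : 0 ≤ β) : 0 ≤ phiC β := by
  unfold phiC; have := pexp_nonneg (plog_nonneg hβ); positivity

/-- [folklore] `0 ≤ psiC β` for `0 ≤ β`. -/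
theorem psiC_nonneg {β : ℝ} (hβ : 0 ≤ β) : 0 ≤ psiC β := by
  unfold psiC; have := phiC_nonneg hβ; positivity

/-- [folklore] THE NUMERAL: `K(3∕22) ≤ 8∕5`. -/
theorem Kmix_num : Kmix (3 / 22) ≤ 8 / 5 := by
  norm_num [Kmix, psiC, phiC, pexp, plog]

/-- [folklore] `(1 + t)^n ≤ 1 ∕ (1 − n·t)` for `0 ≤ t`, `n·t < 1`. -/
theorem one_add_pow_le {t : ℝ} (ht : 0 ≤ t) : ∀ {n : ℕ}, (n : ℝ) * t < 1 → (1 + t) ^ n ≤ 1 / (1 - n * t)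
  | 0, _ => by simp
  | n + 1, h => by
    have h' : ((n : ℝ) + 1) * t < 1 := by push_cast at h; exact h
    have hn : (n : ℝ) * t < 1 := by nlinarith
    have ih := one_add_pow_le ht hn
    have hpos' : 0 < 1 - ((n : ℝ) + 1) * t := by linarith
    push_cast
    rw [pow_succ, le_div_iff₀ hpos']
    have key : (1 + t) * (1 - ((n : ℝ) + 1) * t) ≤ 1 - n * t := by
      nlinarith [mul_nonneg (show (0 : ℝ) ≤ n + 1 by positivity) (mul_self_nonneg t)]
    calc (1 + t) ^ n * (1 + t) * (1 - ((n : ℝ) + 1) * t) = (1 + t) ^ n * ((1 + t) * (1 - ((n : ℝ) + 1) * t)) := by ring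
      _ ≤ 1 / (1 - n * t) * (1 - n * t) := mul_le_mul ih key (mul_nonneg (by positivity) hpos'.le) (by positivity)
      _ = 1 := by have hpos : (1 - (n : ℝ) * t) ≠ 0 := by linarith
                  rw [div_mul_cancel₀ _ hpos]

end Constants

end Summit.QuantumFields.BalabanUV.Beta.D1BFx.TruncatedAlgebraNorms

end
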